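import Literature.Analysis.OperatorTheory.KreinLangerDefinitization
import Summits.RiemannHypothesis.RiemannHypothesis.Theorems.RuelleBandCofiniteCriticalLineStubDefinitizeAux2
import HarnessLib

/-!
# Stub `stub_definitize` of line `cofinite-weil-index-staircase` (crux `RuelleBand.CofiniteCriticalLine`,
item stmt-RiemannHypothesis-2064): DEFINITIZATION, conditional on Kreĭn's theorem

Registered stub (skeleton `Cruxes/CofiniteCriticalLine/Lines/cofinite-weil-index-staircase.lean`):
a UNIFORM bound `N` on the negative index of `Re Q` (`Q = weilQuadratic`) over all windows
`[-a, a]` implies that every test function `f` has a non-zero polynomial `p`, `deg p ≤ N`, with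
`Re Q ≥ 0` on the translation span of `h := p(-D) f = Σ_j p_j (-1)^j f^{(j)}`.

Proof (tree side, unconditional, in the two `…Aux` files): on the ZERO SIDE of the explicit
formula (`explicit_formula_holds`) the Gram matrix of `Q` on translates of a test function `g` is
the Toeplitz matrix of the smooth Hermitian kernel
`B_g(x) = Σ_ρ m(ρ) ĝ(ρ) conj ĝ(1-ρ̄) e^{(ρ-1/2)x}` (`= WeilConverse.expSum g`):
`Q(Σ_k c_k g(· - x_k)) = Σ_{k,l} c_k c̄_l B_g(x_k - x_l)`; the window-index bound says that `B_f`
has at most `N` negative squares; and `B_h = P(-iD) P♯(-iD) B_f` for `h = p(-D) f`,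
`p(X) = P(-iX)` (`B_f^{(r)} = Σ_ρ m(ρ) P_f(ρ) (ρ-1/2)^r e^{(ρ-1/2)x}`, `ĥ(s) = p(s-1/2) f̂(s)`).
The one external input is KREĬN'S DEFINITIZATION THEOREM for functions with finitely many negative
squares (Kreĭn 1959; Stewart 1972 Thm. 3.1 with Thm. 2.4; via Pontryagin's invariant-subspace
theorem in `Π_κ`), the cited named fact `Literature.Analysis.OperatorTheory.KreinDefinitization`
(`Literature/Analysis/OperatorTheory/KreinLangerDefinitization.lean`, relocated there by the gate
from the first submission of this file; special case: smooth kernels, pointwise form), taken as a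
hypothesis: `stub_definitize_of_krein : KreinDefinitization → stub` (and `stub_definitize_aux3`,
the same with the hypothesis written out).  The fact is not proved in the tree (Pontryagin-space
operator theory is missing), so the stub is landed CONDITIONALLY.
-/

set_option linter.dupNamespace false

noncomputable section

namespace Summit.RiemannHypothesis.RiemannHypothesis.Theorems.RuelleBandCofiniteCriticalLine

open Literature.Analysis.OperatorTheory

/-- **Stub `stub_definitize` with Kreĭn's definitization theorem as an explicit, written-out
hypothesis** (registered sub-goal `stub_definitize_aux3`; the antecedent is verbatim the body of
`Literature.Analysis.OperatorTheory.KreinDefinitization`, so that this statement does not mention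
the fact by name).  If the negative index of `Re Q` on window test functions is uniformly
bounded by `N`, then (granted the definitization theorem) every test function `f` has a non-zero polynomial `p` with `deg p ≤ N`
such that `Re Q ≥ 0` on the translation span of `h = p(-D) f = Σ_{j ≤ deg p} p_j (-1)^j f^{(j)}`.
Proof: the hypothesis is applied to `F := B_f = WeilConverse.expSum f` (smooth:
`stub_definitize_contDiff_expSum`; Hermitian: `stub_definitize_expSum_neg`; at most `N` negative
squares: `stub_definitize_negSquares_le`, from the index bound through the orbit formula
`Q(Σ c_k f(· - x_k)) = Σ c_k c̄_l B_f(x_k - x_l)`); with `p(X) := P(-iX)`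
(`stub_definitize_exists_twist`) the definitized kernel `P(-iD) P♯(-iD) B_f` is `B_h`, whose
Toeplitz forms are the values of `Q` on the translation span of `h`
(`stub_definitize_weilQuadratic_orbit_derivPoly`). [folklore] -/
theorem stub_definitize_aux3 :
    (∀ (κ : ℕ) (F : ℝ → ℂ), ContDiff ℝ ((⊤ : ℕ∞) : WithTop ℕ∞) F →
      (∀ x, F (-x) = (starRingEnd ℂ) (F x)) →
      (∀ (n : ℕ) (x : Fin n → ℝ) (v : Fin (κ + 1) → Fin n → ℂ), ∃ w : Fin (κ + 1) → ℂ, w ≠ 0 ∧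
        0 ≤ (∑ k, ∑ l, (∑ i, w i * v i k) * (starRingEnd ℂ) (∑ i, w i * v i l) *
          F (x k - x l)).re) →
      ∃ P : Polynomial ℂ, P ≠ 0 ∧ P.natDegree ≤ κ ∧
        ∀ (n : ℕ) (x : Fin n → ℝ) (c : Fin n → ℂ),
          0 ≤ (∑ k, ∑ l, c k * (starRingEnd ℂ) (c l) *
            ∑ j ∈ Finset.range (P.natDegree + 1), ∑ m ∈ Finset.range (P.natDegree + 1),
              P.coeff j * (starRingEnd ℂ) (P.coeff m) * (-Complex.I) ^ (j + m) *
                iteratedDeriv (j + m) F (x k - x l)).re) →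
    (∃ N : ℕ, ∀ a : ℝ, ∀ g : Fin (N + 1) → ℝ → ℂ, (∀ i, Literature.NumberTheory.LFunctions.IsWeilTest (g i)) →
        (∀ i, tsupport (g i) ⊆ Set.Icc (-a) a) →
        ∃ c : Fin (N + 1) → ℂ, c ≠ 0 ∧
          0 ≤ (Literature.NumberTheory.LFunctions.weilQuadratic (fun t => ∑ i, c i * g i t)).re) →
    ∃ D : ℕ, ∀ f : ℝ → ℂ, Literature.NumberTheory.LFunctions.IsWeilTest f →
      ∃ p : Polynomial ℂ, p ≠ 0 ∧ p.natDegree ≤ D ∧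
      ∀ (n : ℕ) (x : Fin n → ℝ) (c : Fin n → ℂ),
        0 ≤ (Literature.NumberTheory.LFunctions.weilQuadratic (fun t => ∑ k, c k *
          (∑ j ∈ Finset.range (p.natDegree + 1),
            p.coeff j * (-1 : ℂ) ^ j * iteratedDeriv j f (t - x k)))).re := by
  rintro hK ⟨N, hN⟩
  refine ⟨N, fun f hf => ?_⟩
  obtain ⟨P, hP0, hPdeg, hpos⟩ := hK N (Literature.NumberTheory.LFunctions.WeilConverse.expSum f)
    (stub_definitize_contDiff_expSum hf) (stub_definitize_expSum_neg f)
    (stub_definitize_negSquares_le hN hf)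
  obtain ⟨p, hp0, hpdeg, hpc⟩ := stub_definitize_exists_twist hP0
  refine ⟨p, hp0, hpdeg.le.trans hPdeg, fun n x c => ?_⟩
  rw [stub_definitize_weilQuadratic_orbit_derivPoly hf p.natDegree p.coeff x c]
  simp_rw [hpc, stub_definitize_twist_coeff, hpdeg]
  exact hpos n x c

/-- **Stub `stub_definitize`, conditional on the named fact
`Literature.Analysis.OperatorTheory.KreinDefinitization`** (registered sub-goal
`stub_definitize_of_krein`): a uniform bound `N` on the negative index of `Re Q` over all
windows implies, granted Kreĭn's definitization theorem, that every test function `f` has a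
non-zero polynomial `p`, `deg p ≤ N`, with `Re Q ≥ 0` on the translation span of `p(-D) f` — the
registered signature of `stub_definitize` behind the implication (`stub_definitize_aux3` with the
hypothesis folded into the cited fact). [folklore] -/
theorem stub_definitize_of_krein : KreinDefinitization →
    (∃ N : ℕ, ∀ a : ℝ, ∀ g : Fin (N + 1) → ℝ → ℂ, (∀ i, Literature.NumberTheory.LFunctions.IsWeilTest (g i)) →
        (∀ i, tsupport (g i) ⊆ Set.Icc (-a) a) →
        ∃ c : Fin (N + 1) → ℂ, c ≠ 0 ∧
          0 ≤ (Literature.NumberTheory.LFunctions.weilQuadratic (fun t => ∑ i, c i * g i t)).re) →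
    ∃ D : ℕ, ∀ f : ℝ → ℂ, Literature.NumberTheory.LFunctions.IsWeilTest f →
      ∃ p : Polynomial ℂ, p ≠ 0 ∧ p.natDegree ≤ D ∧
      ∀ (n : ℕ) (x : Fin n → ℝ) (c : Fin n → ℂ),
        0 ≤ (Literature.NumberTheory.LFunctions.weilQuadratic (fun t => ∑ k, c k *
          (∑ j ∈ Finset.range (p.natDegree + 1),
            p.coeff j * (-1 : ℂ) ^ j * iteratedDeriv j f (t - x k)))).re :=
  fun hK => stub_definitize_aux3 hK

end Summit.RiemannHypothesis.RiemannHypothesis.Theorems.RuelleBandCofiniteCriticalLine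

end
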